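import Literature.Computability.AlgebraicComplexity.PochhammerWilkinsonDefinable
import Literature.Computability.Complexity.CountingHierarchyInter
import Literature.Computability.Complexity.IteratedAdditionBits
import Literature.Computability.Complexity.CountingHierarchyProofs
import Literature.Computability.Complexity.StackBricksArith
import Literature.Computability.Complexity.HashBricks
import Literature.Computability.Complexity.BrickAlgebra
import Literature.Computability.Complexity.LengthCompare
import Literature.Computability.Complexity.ListFoldBricks
import Literature.Computability.Complexity.FPStringBricks
import HarnessLib

/-!
# Bürgisser's Cor. 3.9 from the bits of one iterated product (block extraction)

Bürgisser, *On defining integers and proving arithmetic circuit lower bounds* (Comput. Complexity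
18 (2009) = ECCC TR06-113), Cor. 3.9: "the sequence of elementary symmetric functions
`(σ_k(1, 2, …, n))_{n ∈ ℕ, k ≤ n}` is definable in `CH`" — the named fact
`Burgisser2009_esymm_chDefinable` of `TauConjectureProofs.lean`, one of the two classical facts the
τ-conjecture transfer theorems now rest on (`TauConjectureTwoFacts.lean`). Its printed proof
(ECCC TR06-113, p. 13) considers `d(n) := ∏_{k=1}^{n} (2^{n²} + k) = ∑_k σ_k(1, …, n) 2^{(n-k) n²}`,
observes "Since `σ_k(1, 2, …, n) < 2^{n²}` there is no overlap of the bit representations, hence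
the bits of `σ_k(1, 2, …, n)` can be read off the bit vector of `d(n)`", and obtains the bits of
`d(n)` in `CH` from Thm. 3.7 (iterated products of `CH`-definable sequences) applied to the
factors `c(n, k) = 2^{n²} + k`, whose bit language is in `P`.

This file PROVES the reading-off step, the bookkeeping of Def. 3.1 and the input side of Thm. 3.7,
reducing Cor. 3.9 to the single hypothesis that Thm. 3.7 delivers for this one product — the bit language
`{⟨u, bin t⟩ | bit t of d(val u) is 1}` of `d` belongs to `CH` (stated inline, in the string
conventions of the `CH` toolkit `Complexity/CH*.lean`: numerals read by `bitsToNat`, components by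
`fstP`/`sndP`):

* `Burgisser2009_esymm_chDefinable_of_prodBits :
    {z | (cor39Prod (val (fstP z))).testBit (val (sndP z))} ∈ CH → Burgisser2009_esymm_chDefinable`.

Contents:
* `cor39N n = n² + 1` (block length; one bit more than print so that `n ≤ 1` needs no case
  distinction), `cor39Prod n = ∏_{k<n} (2^N + (k+1))`;
* Vieta at `X = 2^N` and at `X = 1` (`Multiset.prod_X_add_C_eq_sum_esymm` for `pwRoots n`):
  `cast_cor39Prod`, `sum_esymm_pwRoots : ∑_k σ_k = (n+1)!`, whence `0 ≤ σ_k ≤ (n+1)! < 2^N`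
  (`esymm_pwRoots_nonneg`, `esymm_pwRoots_le_factorial`, `factorial_succ_lt_two_pow`) and the
  polynomial bit-size `σ_k ≤ 2^{n²}` of Def. 3.1 (4);
* base-`2^N` digits and their bits: `cor39Digit`, `cor39Prod_eq_digits`, **`testBit_cor39Prod`**
  (bit `N (n-k) + t` of `d(n)` is bit `t` of `σ_k`, `t < N`; by the digit lemma
  `testBit_sum_two_pow_mul_digit` of `IteratedAdditionBits.lean`), `testBit_esymm_of_le`
  (higher bits vanish);
* the bit language of Def. 3.1 for `σ`: total readers `cor39QN/cor39QK/cor39QJ/cor39QB` of a query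
  `⟨⟨bin n, bin k⟩, ⟨bin j, [b]⟩⟩` (`encBitQuery`), the `FP` position map
  `cor39PosMap : query ↦ ⟨bin n, bin (N (n-k) + j)⟩` (bricks `addFn`/`prodFn`/`subFn`), the tests
  `j < N` and `b = 1` in `P`, and `cor39BitLang H ∈ CH` for `H ∈ CH` (closure of `CH` under `FP`
  preimages, `P` intersections, complement, union); the sign language is `⊤` (`σ_k ≥ 0`);
* the input format of Thm. 3.7: `d` as the iterated product of the factor family `cor39Factor`
  (`⟨u, bin k⟩ ↦ 2^N + (k+1)` for `k < n`, `1` beyond) over any range `k < M ≥ n`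
  (`prod_cor39Factor`, `prod_cor39Factor_two_pow`), the size `cor39Factor_lt`, the bits of the
  factors in closed form (`testBit_cor39Factor`) and **their bit language in `P`**
  (`cor39Factor_bits_mem_P` / `_mem_CH`: `{⟨⟨u, bin k⟩, bin t⟩ | bit t of the factor is 1}`, the
  bricks `cor39LowNum`, `cor39LowBit`, `cor39FactorBit`), so that Thm. 3.7 applies to `d` verbatim.

## References

* P. Bürgisser, *On defining integers and proving arithmetic circuit lower bounds*, Comput.
  Complexity 18 (2009) 81–103 = ECCC TR06-113, Def. 3.1, Thm. 3.7, Cor. 3.9 and its proof.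
* W. Hesse, E. Allender, D. A. M. Barrington, *Uniform constant-depth threshold circuits for
  division and iterated multiplication*, JCSS 65 (2002) 695–716 (the arithmetic behind Thm. 3.7).
-/

noncomputable section

open Computability Polynomial Finset
open Literature.Computability.Complexity Literature.Computability.Complexity.Classes Brick

namespace Literature.Computability.AlgebraicComplexity

/-! ### The padded product and Vieta at `X = 2^N` -/

/-- The block length `N = n² + 1` (Bürgisser uses `2^{n²}`; one more bit also covers `n ≤ 1`). [cite: Burgisser2006, proof of Cor. 3.9] -/
def cor39N (n : ℕ) : ℕ := n ^ 2 + 1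

/-- **Bürgisser's padded product** `d(n) = ∏_{k=1}^{n} (2^N + k)` whose base-`2^N` digits are the
elementary symmetric functions `σ_{n-i}(1, …, n)`. [cite: Burgisser2006, proof of Cor. 3.9] -/
def cor39Prod (n : ℕ) : ℕ := ∏ k ∈ range n, (2 ^ cor39N n + (k + 1))

/-- `σ_j(1, …, n) ≥ 0` (a sum of products of positive integers). [folklore] -/
theorem esymm_pwRoots_nonneg (n j : ℕ) : 0 ≤ (pwRoots n).esymm j := by
  rw [Multiset.esymm]
  refine Multiset.sum_nonneg fun x hx => ?_
  obtain ⟨t, ht, rfl⟩ := Multiset.mem_map.1 hx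
  exact Multiset.prod_nonneg fun y hy =>
    (zero_lt_one.trans_le (mem_pwRoots_iff.1 (Multiset.mem_of_le (Multiset.mem_powersetCard.1 ht).1 hy)).1).le

/-- The padded product over `ℤ` as a product over the roots `1, …, n`. [folklore] -/
theorem prod_map_pwRoots_add (n : ℕ) :
    ((pwRoots n).map fun r : ℤ => (2 : ℤ) ^ cor39N n + r).prod = (cor39Prod n : ℤ) := by
  rw [pwRoots, Multiset.map_map, cor39Prod, Nat.cast_prod, Finset.prod_eq_multiset_prod, Finset.range_val]
  simp only [Function.comp_def]
  congr 1

/-- **Vieta at `X = 2^N`**: `d(n) = ∑_{j ≤ n} σ_j(1, …, n) · 2^{N (n - j)}` (over `ℤ`). [cite: Burgisser2006, proof of Cor. 3.9] -/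
theorem cast_cor39Prod (n : ℕ) :
    (cor39Prod n : ℤ) = ∑ j ∈ range (n + 1), (pwRoots n).esymm j * 2 ^ (cor39N n * (n - j)) := by
  have hV := congrArg (Polynomial.eval ((2 : ℤ) ^ cor39N n)) (Multiset.prod_X_add_C_eq_sum_esymm (pwRoots n))
  rw [Polynomial.eval_multiset_prod, Polynomial.eval_finsetSum, card_pwRoots] at hV
  simp only [Multiset.map_map, Function.comp_def, Polynomial.eval_add, Polynomial.eval_X, Polynomial.eval_C,
    Polynomial.eval_mul, Polynomial.eval_pow] at hV
  rw [prod_map_pwRoots_add] at hV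
  rw [hV]
  refine Finset.sum_congr rfl fun j _ => ?_
  rw [← pow_mul]

/-- `∏_{k=1}^{n} (1 + k) = (n + 1)!`. [folklore] -/
theorem prod_map_one_add_pwRoots (n : ℕ) : ((pwRoots n).map fun r : ℤ => 1 + r).prod = ((n + 1).factorial : ℤ) := by
  induction n with
  | zero => simp [pwRoots]
  | succ m ih =>
    have h : pwRoots (m + 1) = ((m : ℤ) + 1) ::ₘ pwRoots m := by
      rw [pwRoots, Multiset.range_succ, Multiset.map_cons]; rfl
    rw [h, Multiset.map_cons, Multiset.prod_cons, ih, Nat.factorial_succ (m + 1)]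
    push_cast
    ring

/-- `∑_{j ≤ n} σ_j(1, …, n) = (n + 1)!` (Vieta at `X = 1`). [folklore] -/
theorem sum_esymm_pwRoots (n : ℕ) : ∑ j ∈ range (n + 1), (pwRoots n).esymm j = ((n + 1).factorial : ℤ) := by
  have hV := congrArg (Polynomial.eval (1 : ℤ)) (Multiset.prod_X_add_C_eq_sum_esymm (pwRoots n))
  rw [Polynomial.eval_multiset_prod, Polynomial.eval_finsetSum, card_pwRoots] at hV
  simp only [Multiset.map_map, Function.comp_def, Polynomial.eval_add, Polynomial.eval_X, Polynomial.eval_C,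
    Polynomial.eval_mul, Polynomial.eval_pow, one_pow, mul_one] at hV
  rw [← hV, prod_map_one_add_pwRoots]

/-- `σ_j(1, …, n) ≤ (n + 1)!`. [folklore] -/
theorem esymm_pwRoots_le_factorial (n j : ℕ) : (pwRoots n).esymm j ≤ ((n + 1).factorial : ℤ) := by
  by_cases hj : j ≤ n
  · rw [← sum_esymm_pwRoots]
    exact Finset.single_le_sum (fun i _ => esymm_pwRoots_nonneg n i) (Finset.mem_range.2 (Nat.lt_succ_of_le hj))
  · have h0 : (pwRoots n).esymm j = 0 := by
      rw [Multiset.esymm, Multiset.powersetCard_eq_empty _ (by rw [card_pwRoots]; omega)]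
      simp
    rw [h0]
    exact_mod_cast (Nat.factorial_pos _).le

/-- `(n + 1)! ≤ (n + 1)^n`. [folklore] -/
theorem factorial_succ_le_pow : ∀ n : ℕ, (n + 1).factorial ≤ (n + 1) ^ n
  | 0 => by simp
  | n + 1 => by
    rw [Nat.factorial_succ, pow_succ']
    exact Nat.mul_le_mul_left _ ((factorial_succ_le_pow n).trans (Nat.pow_le_pow_left (Nat.le_succ _) _))

/-- `(n + 1)! < 2^N`, `N = n² + 1`. [cite: Burgisser2006, proof of Cor. 3.9] -/
theorem factorial_succ_lt_two_pow (n : ℕ) : (n + 1).factorial < 2 ^ cor39N n := by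
  have h1 : (n + 1) ^ n ≤ (2 ^ n) ^ n := Nat.pow_le_pow_left (Nat.lt_two_pow_self) n
  rw [← pow_mul] at h1
  have h2 : 2 ^ (n * n) < 2 ^ cor39N n := Nat.pow_lt_pow_right (by norm_num) (by unfold cor39N; nlinarith)
  exact ((factorial_succ_le_pow n).trans h1).trans_lt h2

/-- **The digits fit in a block**: `σ_j(1, …, n) < 2^N`. [cite: Burgisser2006, proof of Cor. 3.9] -/
theorem toNat_esymm_pwRoots_lt (n j : ℕ) : ((pwRoots n).esymm j).toNat < 2 ^ cor39N n := by
  have h := (esymm_pwRoots_le_factorial n j).trans_lt (show ((n + 1).factorial : ℤ) < 2 ^ cor39N n by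
    exact_mod_cast factorial_succ_lt_two_pow n)
  have h' : ((((pwRoots n).esymm j).toNat : ℕ) : ℤ) < 2 ^ cor39N n := by
    rw [Int.toNat_of_nonneg (esymm_pwRoots_nonneg n j)]; exact h
  exact_mod_cast h'

/-- `|σ_j| = σ_j` read in `ℕ`. [folklore] -/
theorem natAbs_esymm_pwRoots (n j : ℕ) : ((pwRoots n).esymm j).natAbs = ((pwRoots n).esymm j).toNat :=
  (Int.toNat_of_nonneg (esymm_pwRoots_nonneg n j) ▸ (Int.natAbs_of_nonneg (esymm_pwRoots_nonneg n j)) ▸ rfl)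

/-! ### Base-`2^N` digits and their bits -/

/-- **The padded digits of `d(n)` in base `2^N`**: digit `i ≤ n` is `σ_{n-i}(1, …, n)`, higher
digits vanish. [cite: Burgisser2006, proof of Cor. 3.9] -/
def cor39Digit (n i : ℕ) : ℕ := if i ≤ n then ((pwRoots n).esymm (n - i)).toNat else 0

/-- The digits fit in a block. [cite: Burgisser2006, proof of Cor. 3.9] -/
theorem cor39Digit_lt (n i : ℕ) : cor39Digit n i < 2 ^ cor39N n := by
  unfold cor39Digit; split_ifs
  · exact toNat_esymm_pwRoots_lt n _
  · exact Nat.two_pow_pos _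

/-- **`d(n)` in base `2^N`**: `d(n) = ∑_{i ≤ n} 2^{N i} · digitᵢ`. [cite: Burgisser2006, proof of Cor. 3.9] -/
theorem cor39Prod_eq_digits (n : ℕ) :
    cor39Prod n = ∑ i ∈ range (n + 1), 2 ^ (cor39N n * i) * cor39Digit n i := by
  apply Nat.cast_injective (R := ℤ)
  rw [cast_cor39Prod, Nat.cast_sum, ← Finset.sum_range_reflect]
  refine Finset.sum_congr rfl fun i hi => ?_
  have hi' : i ≤ n := Nat.lt_succ_iff.1 (Finset.mem_range.1 hi)
  rw [cor39Digit, if_pos hi', Nat.cast_mul, Nat.cast_pow, Nat.cast_ofNat,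
    Int.toNat_of_nonneg (esymm_pwRoots_nonneg _ _), show n + 1 - 1 - i = n - i from by omega,
    Nat.sub_sub_self hi', mul_comm]

/-- **Block extraction**: for `k ≤ n` and `t < N`, bit `N (n - k) + t` of `d(n)` is bit `t` of
`σ_k(1, …, n)` (the base-`2ᴷ` digit lemma `testBit_sum_two_pow_mul_digit` of the iterated-addition
toolkit). [cite: Burgisser2006, proof of Cor. 3.9] -/
theorem testBit_cor39Prod {n k t : ℕ} (hk : k ≤ n) (ht : t < cor39N n) :
    (cor39Prod n).testBit (cor39N n * (n - k) + t) = (((pwRoots n).esymm k).toNat).testBit t := by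
  have hN : 0 < cor39N n := Nat.succ_pos _
  rw [cor39Prod_eq_digits, testBit_sum_two_pow_mul_digit hN (n + 1) (cor39Digit n) (cor39Digit_lt n)
    (fun γ hγ => if_neg (by omega)), Nat.mul_add_div hN, Nat.div_eq_of_lt ht, add_zero, Nat.mul_add_mod,
    Nat.mod_eq_of_lt ht, cor39Digit, if_pos (Nat.sub_le n k), Nat.sub_sub_self hk]

/-- Bits of `σ_k(1, …, n)` at positions `≥ N` vanish. [folklore] -/
theorem testBit_esymm_of_le {n k t : ℕ} (ht : cor39N n ≤ t) : (((pwRoots n).esymm k).toNat).testBit t = false :=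
  Nat.testBit_eq_false_of_lt ((toNat_esymm_pwRoots_lt n k).trans_le (Nat.pow_le_pow_right (by norm_num) ht))

/-- `(n + 1)! ≤ 2^{n²}`. [folklore] -/
theorem factorial_succ_le_two_pow_sq (n : ℕ) : (n + 1).factorial ≤ 2 ^ (n ^ 2) := by
  have h1 : (n + 1) ^ n ≤ (2 ^ n) ^ n := Nat.pow_le_pow_left (Nat.lt_two_pow_self (n := n)) n
  rw [← pow_mul, ← sq] at h1
  exact (factorial_succ_le_pow n).trans h1

/-! ### The query readers and the position map -/

/-- The `n` of a bit query `⟨⟨bin n, bin k⟩, ⟨bin j, [b]⟩⟩` (total reader). [cite: Burgisser2006, §3] -/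
def cor39QN (w : List Bool) : ℕ := bitsToNat (fstP (fstP w))

/-- The `k` of a bit query (total reader). [cite: Burgisser2006, §3] -/
def cor39QK (w : List Bool) : ℕ := bitsToNat (sndP (fstP w))

/-- The `j` of a bit query (total reader). [cite: Burgisser2006, §3] -/
def cor39QJ (w : List Bool) : ℕ := bitsToNat (fstP (sndP w))

/-- The `b` of a bit query (total reader: the head letter of the last field). [cite: Burgisser2006, §3] -/
def cor39QB (w : List Bool) : Bool := (sndP (sndP w)).headD false

/-- The readers on a genuine query. [folklore] -/
theorem cor39Q_encBitQuery (n k j : ℕ) (b : Bool) :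
    cor39QN (encBitQuery n k j b) = n ∧ cor39QK (encBitQuery n k j b) = k ∧ cor39QJ (encBitQuery n k j b) = j ∧
      cor39QB (encBitQuery n k j b) = b := by
  simp [cor39QN, cor39QK, cor39QJ, cor39QB, encBitQuery, encIdx]

/-- `fstF = fstP` (brick and projection namespaces name the same function; public copy:
`PermanentCodeTranscoder.fstF_eq_fstP`, not imported here). [folklore] -/
private theorem fstF_eq_fstP' : fstF = fstP := rfl

/-- `sndF = sndP` (see `fstF_eq_fstP'`). [folklore] -/
private theorem sndF_eq_sndP' : sndF = sndP := rfl

/-- The numeral of the block length `N = n² + 1` of the query's `n`. [folklore] -/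
def cor39BlockNum : List Bool → List Bool :=
  addFn ∘ fanoutFn (prodFn ∘ fanoutFn (fstF ∘ fstF) (fstF ∘ fstF)) fun _ => [true]

/-- Value of `cor39BlockNum`. [folklore] -/
theorem cor39BlockNum_apply (w : List Bool) : cor39BlockNum w = encodeNat (cor39N (cor39QN w)) := by
  simp [cor39BlockNum, cor39N, cor39QN, sq, fstF_eq_fstP']

/-- `cor39BlockNum ∈ FP`. [folklore] -/
theorem cor39BlockNum_mem_FP : cor39BlockNum ∈ FP :=
  comp_mem_FP addFn_mem_FP (fanoutFn_mem_FP (comp_mem_FP prodFn_mem_FP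
    (fanoutFn_mem_FP (comp_mem_FP fstF_mem_FP fstF_mem_FP) (comp_mem_FP fstF_mem_FP fstF_mem_FP))) (const_mem_FP _))

/-- The numeral of the bit position `N (n - k) + j` inside `d(n)`. [cite: Burgisser2006, proof of Cor. 3.9] -/
def cor39PosNum : List Bool → List Bool :=
  addFn ∘ fanoutFn (prodFn ∘ fanoutFn cor39BlockNum (subFn ∘ fstF)) (fstF ∘ sndF)

/-- Value of `cor39PosNum`. [folklore] -/
theorem cor39PosNum_apply (w : List Bool) : cor39PosNum w = encodeNat (cor39N (cor39QN w) * (cor39QN w - cor39QK w) + cor39QJ w) := by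
  simp only [cor39PosNum, Function.comp_apply, fanoutFn_apply, cor39BlockNum_apply, prodFn_boolPair, bitsToNat_encodeNat,
    addFn_boolPair, cor39QN, cor39QK, cor39QJ, fstF_eq_fstP', sndF_eq_sndP']
  have hsub : subFn (fstP w) = encodeNat (bitsToNat (fstP (fstP w)) - bitsToNat (sndP (fstP w))) := rfl
  rw [hsub, bitsToNat_encodeNat]

/-- `cor39PosNum ∈ FP`. [folklore] -/
theorem cor39PosNum_mem_FP : cor39PosNum ∈ FP :=
  comp_mem_FP addFn_mem_FP (fanoutFn_mem_FP (comp_mem_FP prodFn_mem_FP (fanoutFn_mem_FP cor39BlockNum_mem_FP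
    (comp_mem_FP subFn_mem_FP fstF_mem_FP))) (comp_mem_FP fstF_mem_FP sndF_mem_FP))

/-- **The position map** `⟨⟨u, v⟩, ⟨x, y⟩⟩ ↦ ⟨u, bin (N (n - k) + j)⟩` into the bit language of `d`. [cite: Burgisser2006, proof of Cor. 3.9] -/
def cor39PosMap : List Bool → List Bool := fanoutFn (fstF ∘ fstF) cor39PosNum

/-- Value of the position map. [folklore] -/
theorem cor39PosMap_apply (w : List Bool) :
    cor39PosMap w = boolPair (fstP (fstP w)) (encodeNat (cor39N (cor39QN w) * (cor39QN w - cor39QK w) + cor39QJ w)) := by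
  rw [cor39PosMap, fanoutFn_apply, cor39PosNum_apply]; rfl

/-- `cor39PosMap ∈ FP`. [folklore] -/
theorem cor39PosMap_mem_FP : cor39PosMap ∈ FP := fanoutFn_mem_FP (comp_mem_FP fstF_mem_FP fstF_mem_FP) cor39PosNum_mem_FP

/-! ### The languages -/

/-- The test `j < N` as a language. [folklore] -/
def cor39JLtLang : Language Bool := {w | cor39QJ w < cor39N (cor39QN w)}

/-- `cor39JLtLang ∈ P` (the comparison brick `ltFn` on `⟨bin j, bin N⟩`). [folklore] -/
theorem cor39JLtLang_mem_P : cor39JLtLang ∈ Classes.P := by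
  have hval : ∀ w, (ltFn ∘ fanoutFn (fstF ∘ sndF) cor39BlockNum) w = [decide (cor39QJ w < cor39N (cor39QN w))] := fun w => by
    simp only [Function.comp_apply, fanoutFn_apply, cor39BlockNum_apply, ltFn_boolPair, bitsToNat_encodeNat,
      fstF_eq_fstP', sndF_eq_sndP']
    rfl
  refine mem_P_of_mem_FP (comp_mem_FP ltFn_mem_FP (fanoutFn_mem_FP (comp_mem_FP fstF_mem_FP sndF_mem_FP)
    cor39BlockNum_mem_FP)) _ fun w => ⟨fun hw => ?_, fun hw => ?_⟩
  · rw [hval, decide_eq_true (show cor39QJ w < cor39N (cor39QN w) from hw)]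
  · rw [hval, decide_eq_false (show ¬ cor39QJ w < cor39N (cor39QN w) from hw)]

/-- The test `b = 1` as a language. [folklore] -/
def cor39BLang : Language Bool := {w | cor39QB w = true}

/-- `cor39BLang ∈ P` (the head-letter brick on the last field). [folklore] -/
theorem cor39BLang_mem_P : cor39BLang ∈ Classes.P := by
  have hval : ∀ w, (HashBricks.headBitFn ∘ sndF ∘ sndF) w = [cor39QB w] := fun w => by
    simp only [Function.comp_apply, HashBricks.headBitFn_apply, sndF_eq_sndP']
    rfl
  refine mem_P_of_mem_FP (comp_mem_FP HashBricks.headBitFn_mem_FP (comp_mem_FP sndF_mem_FP sndF_mem_FP)) _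
    fun w => ⟨fun hw => ?_, fun hw => ?_⟩
  · rw [hval, show cor39QB w = true from hw]
  · rw [hval, Bool.eq_false_iff.2 (show ¬ cor39QB w = true from hw)]

/-- **The bit language of Cor. 3.9** read off a bit language `H` of `d`:
`b = 1 ↔ (j < N ∧ bit N(n-k)+j of d(n) is 1)`. [cite: Burgisser2006, proof of Cor. 3.9] -/
def cor39BitLang (H : Language Bool) : Language Bool :=
  (cor39BLang ⊓ (cor39JLtLang ⊓ cor39PosMap ⁻¹' H)) ⊔ (cor39BLangᶜ ⊓ (cor39JLtLang ⊓ cor39PosMap ⁻¹' H)ᶜ)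

/-- Membership in the bit language. [folklore] -/
theorem mem_cor39BitLang_iff (H : Language Bool) (w : List Bool) :
    w ∈ cor39BitLang H ↔ (cor39QB w = true ↔ (cor39QJ w < cor39N (cor39QN w) ∧ cor39PosMap w ∈ H)) := by
  change (cor39QB w = true ∧ (cor39QJ w < cor39N (cor39QN w) ∧ cor39PosMap w ∈ H)) ∨
    (¬ cor39QB w = true ∧ ¬ (cor39QJ w < cor39N (cor39QN w) ∧ cor39PosMap w ∈ H)) ↔ _
  tauto

/-- **The bit language is in `CH`** when `H` is (closure of `CH` under `FP` preimages, `P`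
intersections, complement and union). [cite: Burgisser2006, proof of Cor. 3.9] -/
theorem cor39BitLang_mem_CH {H : Language Bool} (hH : H ∈ CH) : cor39BitLang H ∈ CH := by
  have hT : cor39JLtLang ⊓ cor39PosMap ⁻¹' H ∈ CH := inter_P_mem_CH cor39JLtLang_mem_P (preimage_mem_CH hH cor39PosMap_mem_FP)
  exact union_mem_CH (inter_P_mem_CH cor39BLang_mem_P hT)
    (inter_P_mem_CH (compl_mem_P_iff.2 cor39BLang_mem_P) (compl_mem_CH hT))

/-! ### Cor. 3.9 from the bits of `d` -/

/-- **Bürgisser's Cor. 3.9 from the bit language of the padded product**: if the language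
`{⟨u, bin t⟩ | bit t of d(val u) is 1}` of the single sequence `d(n) = ∏_{k=1}^{n} (2^{n²+1} + k)`
belongs to `CH` — which is what Thm. 3.7 (iterated multiplication of `CH`-definable sequences
in `CH`) delivers for this product of `P`-definable factors — then the sequence of elementary
symmetric functions `(σ_k(1, …, n))_{n, k ≤ n}` is definable in `CH` (`Burgisser2009_esymm_chDefinable`)
— "there is no overlap of the bit representations, hence the bits of `σ_k(1, 2, …, n)` can be read
off the bit vector of `d(n)`". [cite: Burgisser2006, Cor. 3.9] -/
theorem Burgisser2009_esymm_chDefinable_of_prodBits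
    (hH : ({z | (cor39Prod (bitsToNat (fstP z))).testBit (bitsToNat (sndP z)) = true} : Language Bool) ∈ CH) :
    Burgisser2009_esymm_chDefinable := by
  refine ⟨⟨1, fun n => by rw [pow_one]; exact Nat.le_succ n⟩, ⟨2, fun n k _ _ => ?_⟩,
    ⟨⊤, P_subset_CH top_mem_P, fun n k _ => ⟨fun _ => esymm_pwRoots_nonneg n k, fun _ => trivial⟩⟩,
    ⟨cor39BitLang _, cor39BitLang_mem_CH hH, fun n k j b hk => ?_⟩⟩
  · -- polynomial bit-size: `σ_k ≤ (n+1)! ≤ 2^{n²}`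
    rw [abs_of_nonneg (esymm_pwRoots_nonneg n k)]
    exact (esymm_pwRoots_le_factorial n k).trans (by exact_mod_cast factorial_succ_le_two_pow_sq n)
  · -- the bit language
    obtain ⟨hn, hk', hj, hb⟩ := cor39Q_encBitQuery n k j b
    rw [mem_cor39BitLang_iff, hb, hj, hn, natAbs_esymm_pwRoots]
    change (b = true ↔ (j < cor39N n ∧
      (cor39Prod (bitsToNat (fstP (cor39PosMap (encBitQuery n k j b))))).testBit
        (bitsToNat (sndP (cor39PosMap (encBitQuery n k j b)))) = true)) ↔ _
    rw [cor39PosMap_apply, fstP_boolPair, sndP_boolPair, bitsToNat_encodeNat, hn, hk', hj,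
      show bitsToNat (fstP (fstP (encBitQuery n k j b))) = n from hn]
    by_cases hjN : j < cor39N n
    · rw [testBit_cor39Prod hk hjN]
      cases b <;> simp [hjN]
    · rw [testBit_esymm_of_le (not_lt.1 hjN)]
      cases b <;> simp [hjN]

/-! ### The product as an iterated product of a factor family (the input format of Thm. 3.7) -/

/-- **The factor family of `d`**: on `⟨u, bin k⟩`, the factor `2^N + (k + 1)` for `k < n = val u`
and `1` beyond (so that the product may run over any range `k < M`, `M ≥ n`). [cite: Burgisser2006, proof of Cor. 3.9] -/
def cor39Factor (w : List Bool) : ℕ :=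
  if bitsToNat (sndP w) < bitsToNat (fstP w) then
    2 ^ cor39N (bitsToNat (fstP w)) + (bitsToNat (sndP w) + 1) else 1

/-- The factor family read at `⟨u, bin k⟩`. [folklore] -/
theorem cor39Factor_boolPair (u : List Bool) (k : ℕ) :
    cor39Factor (boolPair u (encodeNat k)) =
      if k < bitsToNat u then 2 ^ cor39N (bitsToNat u) + (k + 1) else 1 := by
  simp [cor39Factor]

/-- **`d(n)` is the iterated product of its factor family** over any range `k < M` with `M ≥ n`. [cite: Burgisser2006, proof of Cor. 3.9] -/
theorem prod_cor39Factor (u : List Bool) {M : ℕ} (hM : bitsToNat u ≤ M) :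
    ∏ k ∈ range M, cor39Factor (boolPair u (encodeNat k)) = cor39Prod (bitsToNat u) := by
  rw [← Finset.prod_range_mul_prod_Ico _ hM, cor39Prod]
  have h1 : ∏ k ∈ range (bitsToNat u), cor39Factor (boolPair u (encodeNat k)) =
      ∏ k ∈ range (bitsToNat u), (2 ^ cor39N (bitsToNat u) + (k + 1)) :=
    Finset.prod_congr rfl fun k hk => by rw [cor39Factor_boolPair, if_pos (Finset.mem_range.1 hk)]
  have h2 : ∏ k ∈ Ico (bitsToNat u) M, cor39Factor (boolPair u (encodeNat k)) = 1 :=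
    Finset.prod_eq_one fun k hk => by
      rw [cor39Factor_boolPair, if_neg (by have := (Finset.mem_Ico.1 hk).1; omega)]
  rw [h1, h2, mul_one]

/-- The product over the natural range `k < 2^{|u|}` (which contains `n = val u < 2^{|u|}`). [folklore] -/
theorem prod_cor39Factor_two_pow (u : List Bool) :
    ∏ k ∈ range (2 ^ u.length), cor39Factor (boolPair u (encodeNat k)) = cor39Prod (bitsToNat u) :=
  prod_cor39Factor u (bitsToNat_lt u).le

/-- `n < 2^N`. [folklore] -/
theorem lt_two_pow_cor39N (n : ℕ) : n < 2 ^ cor39N n := by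
  unfold cor39N
  exact (Nat.lt_two_pow_self).trans_le (Nat.pow_le_pow_right (by norm_num) (by nlinarith))

/-- The factors are below `2^{N+1}`: `2^N + (k+1) ≤ 2^N + n < 2^{N+1}`. [folklore] -/
theorem cor39Factor_lt (w : List Bool) : cor39Factor w < 2 ^ (cor39N (bitsToNat (fstP w)) + 1) := by
  unfold cor39Factor
  split_ifs with h
  · have h1 := lt_two_pow_cor39N (bitsToNat (fstP w))
    rw [pow_succ]; omega
  · exact Nat.one_lt_two_pow (by unfold cor39N; omega)

/-- `bit t of 1 = [t = 0]` (public copy: `Cryptography.testBit_one_eq_decide`, not importable here). [folklore] -/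
private theorem one_testBit_eq (t : ℕ) : Nat.testBit 1 t = decide (t = 0) := by
  cases t with
  | zero => rfl
  | succ t => rw [Nat.testBit_add_one]; simp

/-- **The bits of a factor**: for `m < 2^N`, bit `t` of `2^N + m` is `[t = N] ∨ bit t of m` (the
`if`-form is the public `testBit_two_pow_add_of_lt` of `BurgisserBooleanPartsModPCircuits.lean`, not
imported here; private Boolean-`or` copy). [folklore] -/
private theorem testBit_two_pow_add_eq_or {N m : ℕ} (hm : m < 2 ^ N) (t : ℕ) :
    (2 ^ N + m).testBit t = (decide (t = N) || m.testBit t) := by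
  rw [show 2 ^ N + m = 2 ^ N * 1 + m by rw [mul_one], Nat.testBit_two_pow_mul_add _ hm]
  rcases lt_trichotomy t N with ht | rfl | ht
  · simp [ht, ht.ne]
  · simp [Nat.testBit_eq_false_of_lt hm]
  · rw [if_neg (not_lt.2 ht.le)]
    have hm' : m.testBit t = false :=
      Nat.testBit_eq_false_of_lt (hm.trans_le (Nat.pow_le_pow_right (by norm_num) ht.le))
    rw [hm', decide_eq_false ht.ne', Bool.false_or, one_testBit_eq, decide_eq_false (by omega)]

/-- **The bits of the factor family**: a Boolean combination of comparisons and bits of `k + 1`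
(hence polynomial-time in the query; the language form is left to the user of Thm. 3.7). [folklore] -/
theorem testBit_cor39Factor (u : List Bool) (k t : ℕ) :
    (cor39Factor (boolPair u (encodeNat k))).testBit t =
      if k < bitsToNat u then (decide (t = cor39N (bitsToNat u)) || (k + 1).testBit t) else decide (t = 0) := by
  rw [cor39Factor_boolPair]
  split_ifs with h
  · exact testBit_two_pow_add_eq_or (by have := lt_two_pow_cor39N (bitsToNat u); omega) t
  · rw [one_testBit_eq]

/-! ### The bit predicate of the factor family is polynomial-time -/

/-- `(bitsToNat l).testBit i = l[i]` (the copy `Com.testBit_bitsToNat` of `StackWordArith.lean`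
sits under the stack-machine development; a three-line private copy). [folklore] -/
private theorem testBit_bitsToNat' : ∀ (l : List Bool) (i : ℕ), (bitsToNat l).testBit i = l.getD i false
  | [], i => by simp
  | b :: l, 0 => by cases b <;> simp [Nat.testBit_zero, Nat.add_mod]
  | b :: l, i + 1 => by
    rw [bitsToNat_cons, Nat.testBit_add_one, List.getD_cons_succ, ← testBit_bitsToNat' l i]
    cases b <;> simp [Nat.add_mul_div_left]

/-- The letter at a position read by `take 1 ∘ drop` with the position capped at the length is
`[1]` iff the word has the letter `1` there (private copy of
`PermanentCodeTranscoder.take_one_drop_min_eq_iff`, not imported here). [folklore] -/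
private theorem take_one_drop_min_eq_iff' (w : List Bool) (k : ℕ) :
    (w.drop (min k w.length)).take 1 = [true] ↔ w.getD k false = true := by
  by_cases hk : k < w.length
  · rw [min_eq_left hk.le, List.take_one_drop_eq_of_lt_length hk, List.getD_eq_getElem _ _ hk]
    simp
  · rw [min_eq_right (not_lt.1 hk), List.drop_length, List.getD_eq_default _ _ (not_lt.1 hk)]
    simp

/-- On `z = ⟨⟨u, v⟩, x⟩`: the numeral of `val v + 1` (the factor's low part `k + 1`). [folklore] -/
def cor39LowNum : List Bool → List Bool := addFn ∘ fanoutFn (sndF ∘ fstF) fun _ => [true]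

/-- Value of `cor39LowNum`. [folklore] -/
theorem cor39LowNum_apply (z : List Bool) : cor39LowNum z = encodeNat (bitsToNat (sndP (fstP z)) + 1) := by
  simp [cor39LowNum, fstF_eq_fstP', sndF_eq_sndP']

/-- `cor39LowNum ∈ FP`. [folklore] -/
theorem cor39LowNum_mem_FP : cor39LowNum ∈ FP :=
  comp_mem_FP addFn_mem_FP (fanoutFn_mem_FP (comp_mem_FP sndF_mem_FP fstF_mem_FP) (const_mem_FP _))

/-- On `z = ⟨⟨u, v⟩, x⟩`: the test `[bit (val x) of (val v + 1)]` (the numeral's letter at the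
position, read by `bitAtFn` through a bounded unary conversion of the position). [folklore] -/
def cor39LowBit : List Bool → List Bool :=
  eqPairFn ∘ fanoutFn (bitAtFn ∘ fanoutFn (binToUnaryFn ∘ fanoutFn cor39LowNum sndF) cor39LowNum) fun _ => [true]

/-- Value of `cor39LowBit`. [folklore] -/
theorem cor39LowBit_apply (z : List Bool) :
    cor39LowBit z = [(bitsToNat (sndP (fstP z)) + 1).testBit (bitsToNat (sndP z))] := by
  simp only [cor39LowBit, Function.comp_apply, fanoutFn_apply, cor39LowNum_apply, binToUnaryFn_boolPair,
    bitAtFn_boolPair, List.length_replicate, eqPairFn_boolPair, sndF_eq_sndP']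
  congr 1
  rw [← Bool.decide_eq_true (b := Nat.testBit _ _)]
  apply Bool.decide_congr
  rw [take_one_drop_min_eq_iff', ← testBit_bitsToNat', bitsToNat_encodeNat]

/-- `cor39LowBit ∈ FP`. [folklore] -/
theorem cor39LowBit_mem_FP : cor39LowBit ∈ FP :=
  comp_mem_FP eqPairFn_mem_FP (fanoutFn_mem_FP (comp_mem_FP bitAtFn_mem_FP (fanoutFn_mem_FP
    (comp_mem_FP binToUnaryFn_mem_FP (fanoutFn_mem_FP cor39LowNum_mem_FP sndF_mem_FP)) cor39LowNum_mem_FP))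
    (const_mem_FP _))

/-- **The bit test of the factor family** on `z = ⟨⟨u, bin k⟩, bin t⟩`:
`[k < n] ? ([t = N] ∨ [bit t of k+1]) : [t = 0]`. [folklore] -/
def cor39FactorBit : List Bool → List Bool :=
  iteFn (ltFn ∘ fanoutFn (sndF ∘ fstF) (fstF ∘ fstF))
    (orFn (eqValFn ∘ fanoutFn sndF cor39BlockNum) cor39LowBit)
    (eqValFn ∘ fanoutFn sndF fun _ => [])

/-- Value of the factor bit test. [folklore] -/
theorem cor39FactorBit_apply (z : List Bool) :
    cor39FactorBit z = [(cor39Factor (fstP z)).testBit (bitsToNat (sndP z))] := by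
  have hc : (ltFn ∘ fanoutFn (sndF ∘ fstF) (fstF ∘ fstF)) z =
      [decide (bitsToNat (sndP (fstP z)) < bitsToNat (fstP (fstP z)))] := by
    simp [fstF_eq_fstP', sndF_eq_sndP']
  have hN : (eqValFn ∘ fanoutFn sndF cor39BlockNum) z =
      [decide (bitsToNat (sndP z) = cor39N (bitsToNat (fstP (fstP z))))] := by
    simp only [Function.comp_apply, fanoutFn_apply, cor39BlockNum_apply, eqValFn_boolPair, bitsToNat_encodeNat,
      sndF_eq_sndP']
    rfl
  have h0 : (eqValFn ∘ fanoutFn sndF fun _ => []) z = [decide (bitsToNat (sndP z) = 0)] := by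
    simp [sndF_eq_sndP']
  by_cases h : bitsToNat (sndP (fstP z)) < bitsToNat (fstP (fstP z))
  · have hc' : (ltFn ∘ fanoutFn (sndF ∘ fstF) (fstF ∘ fstF)) z = [true] := by rw [hc, decide_eq_true h]
    rw [cor39FactorBit, iteFn_apply_true hc', orFn_apply hN (cor39LowBit_apply z), cor39Factor, if_pos h,
      testBit_two_pow_add_eq_or (by have := lt_two_pow_cor39N (bitsToNat (fstP (fstP z))); omega)]
  · have hc' : (ltFn ∘ fanoutFn (sndF ∘ fstF) (fstF ∘ fstF)) z = [false] := by rw [hc, decide_eq_false h]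
    rw [cor39FactorBit, iteFn_apply_false hc', h0, cor39Factor, if_neg h, one_testBit_eq]

/-- `cor39FactorBit ∈ FP`. [folklore] -/
theorem cor39FactorBit_mem_FP : cor39FactorBit ∈ FP :=
  iteFn_mem_FP (comp_mem_FP ltFn_mem_FP (fanoutFn_mem_FP (comp_mem_FP sndF_mem_FP fstF_mem_FP)
    (comp_mem_FP fstF_mem_FP fstF_mem_FP)))
    (orFn_mem_FP (comp_mem_FP eqValFn_mem_FP (fanoutFn_mem_FP sndF_mem_FP cor39BlockNum_mem_FP)) cor39LowBit_mem_FP)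
    (comp_mem_FP eqValFn_mem_FP (fanoutFn_mem_FP sndF_mem_FP (const_mem_FP _)))

/-- **The bit language of the factor family is in `P`** (hence in `CH`): the input hypothesis of
Thm. 3.7 for the product `d`, in the conventions of the `CH` toolkit. [cite: Burgisser2006, proof of Cor. 3.9] -/
theorem cor39Factor_bits_mem_P :
    ({z | (cor39Factor (fstP z)).testBit (bitsToNat (sndP z)) = true} : Language Bool) ∈ Classes.P :=
  mem_P_of_mem_FP cor39FactorBit_mem_FP _ fun z =>
    ⟨fun hz => by rw [cor39FactorBit_apply, show (cor39Factor (fstP z)).testBit (bitsToNat (sndP z)) = true from hz],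
     fun hz => by
      rw [cor39FactorBit_apply, Bool.eq_false_iff.2 (show ¬ (cor39Factor (fstP z)).testBit (bitsToNat (sndP z)) = true from hz)]⟩

/-- The same in `CH`. [cite: Burgisser2006, proof of Cor. 3.9] -/
theorem cor39Factor_bits_mem_CH :
    ({z | (cor39Factor (fstP z)).testBit (bitsToNat (sndP z)) = true} : Language Bool) ∈ CH :=
  P_subset_CH cor39Factor_bits_mem_P

end Literature.Computability.AlgebraicComplexity
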